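import Mathlib
import Literature.Combinatorics.Optimization.TracialDesigns
import HarnessLib

/-!
# Cell pnp-psdrank, route `ChebyshevTracialDesign`: the GENERAL-POSITION BUDGET LEMMA for the dense non-crossing psd cell —
# a rank-one cut side whose directions are in general position is x-SPARSE (crux `TracialDecayExp20`, stmt-PneNP-19878;
# eng g13, typing MEMO-14 §5(b)/(d)(4) of the prover's incidence-rigidity line)

After bricks 51–57 the crux is its dense non-crossing psd cell (MEMO-14 §1 `hred_exp`); MEMO-14 §5 proposes to control it by the DENSITY of
tight pairs (quantitative spectral non-tightness (SNT-q), mod Keevash–Lifshitz [cite: Rothvoss2017, §2 (PDF pp. 5–6): tight pairs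
`|δ(U) ∩ M| = 1`]) combined with the EXACT orthogonality of ranges on tight pairs [cite: BrietDadushPokutta2014, Thm. 6 (§3): `X_U Y_M = 0`].
This file is the first statement of that line in which the DIMENSION enters: an incidence count in `ℝ^r`.

* §1 `exists_heavy_subset_lt`, **`exists_disjoint_heavy_groups`** (GREEDY PARTITION) — a weight `x` with values in `[0,1]` and total mass
  `≥ k·(θ+1)` contains `k` pairwise disjoint groups each of mass `≥ θ` (a minimal-cardinality `θ`-heavy subset weighs `< θ + 1`).
* §2 `eq_zero_of_mulVec_eq_zero_of_linearIndependent`, **`card_annihilated_lt_of_generalPosition`** (INCIDENCE COUNT) — if the directions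
  `u_U ∈ ℝ^r`, `U ∈ S`, are in GENERAL POSITION (any `r` of them linearly independent), then a nonzero matrix `Y` annihilates (`Y u_U = 0`) fewer
  than `r` of them.
* §3 **`sum_mul_hits_gt`**, **`groups_lt_two_mul_of_incidence`** (DOUBLE COUNT) — for weights `x` (cuts), `y ≥ 0` (matchings) satisfying the
  (SNT-q)-EXISTENCE HYPOTHESIS WITH HEAVY SUB-WEIGHTS (every `x' ≤ x` of mass `≥ θ` and every `y' ≤ y` carrying at least half of `y` have an active
  tight pair), every `θ`-heavy group of cuts is tight-adjacent to MORE THAN HALF of `y`; so `k` disjoint `θ`-heavy groups force a matching `M`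
  (`y_M > 0`) with more than `k/2` active tight partners in distinct groups; if every active matching has at most `d` active tight partners,
  then `k < 2d`, and (greedy) **`sum_lt_of_incidence`**: `Σ_U x_U < max(2d,1)·(θ+1)`.
* §4 **`mulVec_eq_zero_of_tight_rankOne`** — for a tight-orthogonal psd rectangle with RANK-ONE cut operators `X_U = x_U·u_Uu_Uᵀ` (`u_U` a unit
  vector), tightness `X_U Y_M = 0` puts the direction of every active tight partner of `M` in `ker Y_M`; hence (§2) under general position every
  `M` with `tr Y_M > 0` has `< r` active tight partners, and **`rankOne_cut_mass_lt_of_generalPosition`**: `Σ_U x_U < max(2(r−1),1)·(θ+1)`,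
  i.e. (`rankOne_traceDensity_lt_of_generalPosition`) total cut trace `< 2r(θ+1)`: with `θ = ε·#t-cuts`, `ε = e^{−c₀·dq n}` the (SNT-q)
  threshold, a general-position rank-one cut side has trace DENSITY `< 2(ε + 1/#t-cuts)` in every dimension — so (MEMO-14 §5(b)) inside the
  budget a DENSE tight rank-one cut side is degenerate: `> k/2` of its directions lie in one kernel `ker Y_M`, the premise of MEMO-14 §5(e).
The (SNT-q) input is an explicit hypothesis (as in brick 59 `…SynchronisationTools.fullRank_cuts_sparse_of_SNT`), to be supplied mod
Keevash–Lifshitz. Stature: support/instrument (no defs, axioms standard). WHAT THIS IS NOT: not the subspace-cover dichotomy, no bound on the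
dense cell's VALUE, nothing on psd rank of `P_PM(K_n)`, no P-vs-NP content. Supports stmt-PneNP-19878.
-/

set_option linter.dupNamespace false -- `Summit.PneNP.PneNP.…`: summit = sub-problem (D-0017)

noncomputable section

open scoped MatrixOrder

namespace Summit.PneNP.PneNP.Theorems.ChebyshevTracialDesignGeneralPositionBudget

open Finset Matrix Literature.Barriers.PneNP Literature.Combinatorics.Optimization

/-! ### §1 Greedy partition of a `[0,1]`-weight into disjoint heavy groups -/

/-- A `θ`-heavy subset (`θ ≥ 0`) of MINIMAL cardinality weighs less than `θ + 1` when all weights are `≤ 1` (removing any element drops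
below `θ`). [folklore] -/
theorem exists_heavy_subset_lt {ι : Type*} [DecidableEq ι] (S : Finset ι) (x : ι → ℝ) (hx1 : ∀ i ∈ S, x i ≤ 1)
    {θ : ℝ} (hθ0 : 0 ≤ θ) (hθ : θ ≤ ∑ i ∈ S, x i) :
    ∃ G, G ⊆ S ∧ θ ≤ ∑ i ∈ G, x i ∧ ∑ i ∈ G, x i < θ + 1 := by
  set F := S.powerset.filter (fun G => θ ≤ ∑ i ∈ G, x i) with hF
  have hSF : S ∈ F := mem_filter.2 ⟨mem_powerset.2 Subset.rfl, hθ⟩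
  obtain ⟨G, hG, hmin⟩ := exists_min_image F Finset.card ⟨S, hSF⟩
  obtain ⟨hGS, hGθ⟩ := mem_filter.1 hG
  have hGS' : G ⊆ S := mem_powerset.1 hGS
  refine ⟨G, hGS', hGθ, ?_⟩
  rcases G.eq_empty_or_nonempty with hGe | ⟨i, hi⟩
  · rw [hGe, sum_empty] at hGθ ⊢
    linarith
  -- removing `i` drops below `θ`, by minimality
  have hlt : ∑ j ∈ G.erase i, x j < θ := by
    by_contra hge
    rw [not_lt] at hge
    have hmem : G.erase i ∈ F := mem_filter.2 ⟨mem_powerset.2 ((erase_subset i G).trans hGS'), hge⟩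
    have h1 := hmin _ hmem
    rw [card_erase_of_mem hi] at h1
    have h2 : 0 < G.card := card_pos.2 ⟨i, hi⟩
    omega
  rw [← add_sum_erase G x hi]
  have := hx1 i (hGS' hi)
  linarith

/-- **GREEDY PARTITION.** A weight `x ≤ 1` with `Σ_{S} x ≥ k·(θ + 1)` (`θ ≥ 0`) admits `k` pairwise DISJOINT groups
`G_0, …, G_{k−1} ⊆ S`, each of mass `Σ_{G_j} x ≥ θ` (peel a minimal `θ`-heavy subset, which weighs `< θ + 1`, and recurse). [folklore] -/
theorem exists_disjoint_heavy_groups {ι : Type*} [DecidableEq ι] (x : ι → ℝ) (hx1 : ∀ i, x i ≤ 1)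
    {θ : ℝ} (hθ : 0 ≤ θ) :
    ∀ (k : ℕ) (S : Finset ι), (k : ℝ) * (θ + 1) ≤ ∑ i ∈ S, x i →
      ∃ G : Fin k → Finset ι, (∀ j, G j ⊆ S) ∧ (∀ j, θ ≤ ∑ i ∈ G j, x i) ∧
        ∀ j j', j ≠ j' → Disjoint (G j) (G j') := by
  intro k
  induction k with
  | zero => exact fun S _ => ⟨fun j => Fin.elim0 j, fun j => Fin.elim0 j, fun j => Fin.elim0 j, fun j => Fin.elim0 j⟩
  | succ k ih =>
    intro S hS
    have hk0 : (0 : ℝ) ≤ (k : ℝ) * (θ + 1) := by positivity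
    have hS' : ((k : ℝ) + 1) * (θ + 1) ≤ ∑ i ∈ S, x i := by push_cast at hS; exact hS
    have hθS : θ ≤ ∑ i ∈ S, x i := by nlinarith
    obtain ⟨G₀, hG₀S, hG₀θ, hG₀lt⟩ := exists_heavy_subset_lt S x (fun i _ => hx1 i) hθ hθS
    have hsplit : ∑ i ∈ S, x i = ∑ i ∈ G₀, x i + ∑ i ∈ S \ G₀, x i := by
      rw [← sum_union disjoint_sdiff, union_sdiff_of_subset hG₀S]
    have hrest : (k : ℝ) * (θ + 1) ≤ ∑ i ∈ S \ G₀, x i := by nlinarith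
    obtain ⟨G, hGS, hGθ, hGd⟩ := ih (S \ G₀) hrest
    refine ⟨Fin.cons G₀ G, fun j => ?_, fun j => ?_, fun j j' hjj' => ?_⟩
    · rcases Fin.eq_zero_or_eq_succ j with rfl | ⟨j, rfl⟩
      · rw [Fin.cons_zero]; exact hG₀S
      · rw [Fin.cons_succ]; exact (hGS j).trans sdiff_subset
    · rcases Fin.eq_zero_or_eq_succ j with rfl | ⟨j, rfl⟩
      · rw [Fin.cons_zero]; exact hG₀θ
      · rw [Fin.cons_succ]; exact hGθ j
    · have hd0 : ∀ i : Fin k, Disjoint G₀ (G i) := fun i => disjoint_of_subset_right (hGS i) disjoint_sdiff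
      rcases Fin.eq_zero_or_eq_succ j with rfl | ⟨j, rfl⟩ <;>
        rcases Fin.eq_zero_or_eq_succ j' with rfl | ⟨j', rfl⟩
      · exact absurd rfl hjj'
      · rw [Fin.cons_zero, Fin.cons_succ]; exact hd0 j'
      · rw [Fin.cons_zero, Fin.cons_succ]; exact (hd0 j).symm
      · rw [Fin.cons_succ, Fin.cons_succ]
        exact hGd j j' fun h => hjj' (by rw [h])

/-! ### §2 Incidence count: general position in `ℝ^r` -/

variable {r : ℕ}

/-- If `r` linearly independent vectors of `ℝ^r` (indexed by a type of cardinality `r`) all lie in the kernel of a square matrix `Y`, then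
`Y = 0` (they span `ℝ^r`). [folklore] -/
theorem eq_zero_of_mulVec_eq_zero_of_linearIndependent {ι : Type*} [Fintype ι] (b : ι → Fin r → ℝ)
    (hb : LinearIndependent ℝ b) (hcard : Fintype.card ι = r) (Y : Matrix (Fin r) (Fin r) ℝ)
    (hY : ∀ i, Y *ᵥ b i = 0) : Y = 0 := by
  -- the span of `b` is everything
  have htop : Submodule.span ℝ (Set.range b) = ⊤ := by
    apply Submodule.eq_top_of_finrank_eq
    rw [finrank_span_eq_card hb, hcard, Module.finrank_fin_fun]
  -- `Y` vanishes on the span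
  have hker : ∀ w : Fin r → ℝ, Y *ᵥ w = 0 := by
    intro w
    have hw : w ∈ Submodule.span ℝ (Set.range b) := by rw [htop]; exact Submodule.mem_top
    refine Submodule.span_induction (p := fun w _ => Y *ᵥ w = 0) ?_ ?_ ?_ ?_ hw
    · rintro _ ⟨i, rfl⟩; exact hY i
    · exact mulVec_zero Y
    · intro v v' _ _ hv hv'; rw [mulVec_add, hv, hv', add_zero]
    · intro c v _ hv; rw [mulVec_smul, hv, smul_zero]
  exact (LinearEquiv.map_eq_zero_iff Matrix.toLin').1
    (LinearMap.ext fun w => by rw [Matrix.toLin'_apply, hker w, LinearMap.zero_apply])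

/-- **INCIDENCE COUNT.** If the directions `u_U`, `U ∈ S`, are in GENERAL POSITION (every `r`-subset of `S` has linearly independent
directions), then a NONZERO matrix `Y` annihilates fewer than `r` of them: `#{U ∈ S : Y u_U = 0} < r`. [folklore] -/
theorem card_annihilated_lt_of_generalPosition {α : Type*} [DecidableEq α] (S : Finset α) (u : α → Fin r → ℝ)
    (hgp : ∀ T : Finset α, T ⊆ S → T.card = r → LinearIndependent ℝ (fun U : T => u U.1))
    {Y : Matrix (Fin r) (Fin r) ℝ} (hY : Y ≠ 0) :
    (S.filter fun U => Y *ᵥ u U = 0).card < r := by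
  by_contra hge
  rw [not_lt] at hge
  obtain ⟨T, hTK, hTcard⟩ := exists_subset_card_eq hge
  have hTS : T ⊆ S := hTK.trans (filter_subset _ _)
  apply hY
  refine eq_zero_of_mulVec_eq_zero_of_linearIndependent (fun U : T => u U.1) (hgp T hTS hTcard) ?_ Y ?_
  · rw [Fintype.card_coe, hTcard]
  · intro U; exact (mem_filter.1 (hTK U.2)).2

/-! ### §3 The double count against the (SNT-q)-existence hypothesis -/

variable {n : ℕ}

/-- **Every heavy group is tight-adjacent to more than half of `y`.** Let `x` (cuts) and `y ≥ 0` (matchings) satisfy the (SNT-q)-EXISTENCE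
HYPOTHESIS WITH HEAVY SUB-WEIGHTS: every `0 ≤ x' ≤ x` of mass `≥ θ` and every `0 ≤ y' ≤ y` with `Σ y ≤ 2 Σ y'` have an active tight pair
(`cc(U,M) = 1`, `x'_U > 0`, `y'_M > 0`). Then for every group `G` of cuts with `Σ_G x ≥ θ`, the matchings having an active tight partner in `G`
carry MORE THAN HALF of `y`: `Σ_M y_M < 2 · Σ_{M : ∃ U ∈ G, x_U > 0, cc(U,M) = 1} y_M`. (Otherwise the complementary sub-weight is heavy and
(SNT-q) produces an active tight pair into it.) [cite: Rothvoss2017, §2 (PDF pp. 5–6)] -/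
theorem sum_lt_two_mul_sum_hit (x : OddSet n → ℝ) (hx0 : ∀ U, 0 ≤ x U) (y : PMatch n → ℝ) (hy : ∀ M, 0 ≤ y M) {θ : ℝ}
    (hSNT : ∀ x' : OddSet n → ℝ, (∀ U, 0 ≤ x' U ∧ x' U ≤ x U) → θ ≤ ∑ U, x' U →
      ∀ y' : PMatch n → ℝ, (∀ M, 0 ≤ y' M ∧ y' M ≤ y M) → ∑ M, y M ≤ 2 * ∑ M, y' M →
        ∃ U M, cc U M = 1 ∧ 0 < x' U ∧ 0 < y' M)
    (G : Finset (OddSet n)) (hG : θ ≤ ∑ U ∈ G, x U) :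
    ∑ M, y M < 2 * ∑ M ∈ univ.filter (fun M => ∃ U ∈ G, 0 < x U ∧ cc U M = 1), y M := by
  classical
  by_contra hge
  rw [not_lt] at hge
  -- the restricted weights
  set x' : OddSet n → ℝ := fun U => if U ∈ G then x U else 0 with hx'
  set H := univ.filter (fun M : PMatch n => ∃ U ∈ G, 0 < x U ∧ cc U M = 1) with hH
  set y' : PMatch n → ℝ := fun M => if M ∈ H then 0 else y M with hy'
  have hx'b : ∀ U, 0 ≤ x' U ∧ x' U ≤ x U := fun U => by
    by_cases hU : U ∈ G <;> simp only [hx', hU, if_true, if_false] <;> exact ⟨by simp [hx0 U], by simp [hx0 U]⟩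
  have hx'm : θ ≤ ∑ U, x' U := by
    rw [hx', ← sum_filter]
    have : univ.filter (fun U => U ∈ G) = G := by ext U; simp
    rw [this]; exact hG
  have hy'b : ∀ M, 0 ≤ y' M ∧ y' M ≤ y M := fun M => by
    by_cases hM : M ∈ H <;> simp only [hy', hM, if_true, if_false] <;> exact ⟨by simp [hy M], by simp [hy M]⟩
  -- `Σ y = Σ_H y + Σ y'`
  have hsplit : ∑ M, y M = ∑ M ∈ H, y M + ∑ M, y' M := by
    have hpt : ∀ M, y M = (if M ∈ H then y M else 0) + y' M := fun M => by
      by_cases hM : M ∈ H <;> simp only [hy', hM, if_true, if_false, add_zero, zero_add]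
    rw [sum_congr rfl fun M _ => hpt M, sum_add_distrib, sum_ite_mem, univ_inter]
  have hy'm : ∑ M, y M ≤ 2 * ∑ M, y' M := by linarith
  obtain ⟨U, M, hcc, hxU, hyM⟩ := hSNT x' hx'b hx'm y' hy'b hy'm
  -- `U ∈ G` with `x_U > 0`, so `M ∈ H`, so `y'_M = 0`
  have hUG : U ∈ G := by
    by_contra hU; simp only [hx', hU, if_false] at hxU; exact lt_irrefl _ hxU
  have hxU' : 0 < x U := by simp only [hx', hUG, if_true] at hxU; exact hxU
  have hMH : M ∈ H := mem_filter.2 ⟨mem_univ _, U, hUG, hxU', hcc⟩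
  simp only [hy', hMH, if_true] at hyM
  exact lt_irrefl _ hyM

/-- **DOUBLE COUNT.** Under the same hypothesis, `k` groups `G_0, …, G_{k−1}` of cuts, each of mass `≥ θ`, satisfy
`k · Σ_M y_M < 2 · Σ_M y_M · hit(M)` for `k ≥ 1`, where `hit(M) = #{j : G_j contains an active tight partner of M}`.
[cite: Rothvoss2017, §2 (PDF pp. 5–6)] -/
theorem sum_mul_hits_gt (x : OddSet n → ℝ) (hx0 : ∀ U, 0 ≤ x U) (y : PMatch n → ℝ) (hy : ∀ M, 0 ≤ y M) {θ : ℝ}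
    (hSNT : ∀ x' : OddSet n → ℝ, (∀ U, 0 ≤ x' U ∧ x' U ≤ x U) → θ ≤ ∑ U, x' U →
      ∀ y' : PMatch n → ℝ, (∀ M, 0 ≤ y' M ∧ y' M ≤ y M) → ∑ M, y M ≤ 2 * ∑ M, y' M →
        ∃ U M, cc U M = 1 ∧ 0 < x' U ∧ 0 < y' M)
    {k : ℕ} (hk : 0 < k) (G : Fin k → Finset (OddSet n)) (hG : ∀ j, θ ≤ ∑ U ∈ G j, x U) :
    (k : ℝ) * ∑ M, y M <
      2 * ∑ M, y M * ((univ.filter fun j : Fin k => ∃ U ∈ G j, 0 < x U ∧ cc U M = 1).card : ℝ) := by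
  classical
  -- sum the per-group majorities over `j`
  have hj : ∀ j : Fin k, ∑ M, y M < 2 * ∑ M ∈ univ.filter (fun M => ∃ U ∈ G j, 0 < x U ∧ cc U M = 1), y M :=
    fun j => sum_lt_two_mul_sum_hit x hx0 y hy hSNT (G j) (hG j)
  have hsum : ∑ j : Fin k, ∑ M, y M < ∑ j : Fin k, 2 * ∑ M ∈ univ.filter (fun M => ∃ U ∈ G j, 0 < x U ∧ cc U M = 1), y M :=
    sum_lt_sum_of_nonempty (univ_nonempty_iff.2 ⟨⟨0, hk⟩⟩) fun j _ => hj j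
  rw [sum_const, card_univ, Fintype.card_fin, nsmul_eq_mul] at hsum
  refine lt_of_lt_of_eq hsum ?_
  -- exchange the sums: `Σ_j Σ_{M hit by j} y_M = Σ_M y_M · #{j : M hit by j}`
  rw [← mul_sum, mul_eq_mul_left_iff]
  left
  simp_rw [sum_filter]
  rw [sum_comm]
  refine sum_congr rfl fun M _ => ?_
  rw [← sum_filter, sum_const, nsmul_eq_mul, mul_comm]

/-- Hence **some active matching is hit by more than `k/2` groups**: there is `M` with `y_M > 0` and `k < 2·hit(M)`.
[cite: Rothvoss2017, §2 (PDF pp. 5–6)] -/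
theorem exists_hit_gt_half (x : OddSet n → ℝ) (hx0 : ∀ U, 0 ≤ x U) (y : PMatch n → ℝ) (hy : ∀ M, 0 ≤ y M) {θ : ℝ}
    (hSNT : ∀ x' : OddSet n → ℝ, (∀ U, 0 ≤ x' U ∧ x' U ≤ x U) → θ ≤ ∑ U, x' U →
      ∀ y' : PMatch n → ℝ, (∀ M, 0 ≤ y' M ∧ y' M ≤ y M) → ∑ M, y M ≤ 2 * ∑ M, y' M →
        ∃ U M, cc U M = 1 ∧ 0 < x' U ∧ 0 < y' M)
    {k : ℕ} (hk : 0 < k) (G : Fin k → Finset (OddSet n)) (hG : ∀ j, θ ≤ ∑ U ∈ G j, x U) :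
    ∃ M, 0 < y M ∧ (k : ℝ) < 2 * ((univ.filter fun j : Fin k => ∃ U ∈ G j, 0 < x U ∧ cc U M = 1).card : ℝ) := by
  classical
  have h := sum_mul_hits_gt x hx0 y hy hSNT hk G hG
  by_contra hno
  simp only [not_exists, not_and, not_lt] at hno
  -- then `y_M · 2·hit(M) ≤ y_M · k` termwise
  have hle : 2 * ∑ M, y M * ((univ.filter fun j : Fin k => ∃ U ∈ G j, 0 < x U ∧ cc U M = 1).card : ℝ) ≤
      (k : ℝ) * ∑ M, y M := by
    rw [mul_sum, mul_sum]
    refine sum_le_sum fun M _ => ?_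
    rcases (hy M).eq_or_lt with h0 | hpos
    · rw [← h0]; simp
    · have := hno M hpos
      nlinarith
  linarith

/-- **`k` disjoint heavy groups need an active matching with more than `k/2` active tight partners; so an INCIDENCE BOUND `d` forces `k < 2d`.**
If every matching `M` with `y_M > 0` has at most `d` active tight partners (`#{U : x_U > 0, cc(U,M) = 1} ≤ d`), then `k` pairwise disjoint
groups of cuts of mass `≥ θ` each satisfy `k < 2d` (for `k ≥ 1`; the hit groups inject into the active tight partners by disjointness).
[cite: Rothvoss2017, §2 (PDF pp. 5–6)] -/
theorem groups_lt_two_mul_of_incidence (x : OddSet n → ℝ) (hx0 : ∀ U, 0 ≤ x U) (y : PMatch n → ℝ) (hy : ∀ M, 0 ≤ y M) {θ : ℝ}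
    (hSNT : ∀ x' : OddSet n → ℝ, (∀ U, 0 ≤ x' U ∧ x' U ≤ x U) → θ ≤ ∑ U, x' U →
      ∀ y' : PMatch n → ℝ, (∀ M, 0 ≤ y' M ∧ y' M ≤ y M) → ∑ M, y M ≤ 2 * ∑ M, y' M →
        ∃ U M, cc U M = 1 ∧ 0 < x' U ∧ 0 < y' M)
    {d : ℕ} (hinc : ∀ M, 0 < y M → (univ.filter fun U : OddSet n => 0 < x U ∧ cc U M = 1).card ≤ d)
    {k : ℕ} (hk : 0 < k) (G : Fin k → Finset (OddSet n)) (hG : ∀ j, θ ≤ ∑ U ∈ G j, x U)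
    (hGd : ∀ j j', j ≠ j' → Disjoint (G j) (G j')) : k < 2 * d := by
  classical
  obtain ⟨M, hyM, hM⟩ := exists_hit_gt_half x hx0 y hy hSNT hk G hG
  set J := univ.filter (fun j : Fin k => ∃ U ∈ G j, 0 < x U ∧ cc U M = 1) with hJ
  -- the hit groups inject into the active tight partners of `M`
  have hJle : J.card ≤ (univ.filter fun U : OddSet n => 0 < x U ∧ cc U M = 1).card := by
    have hw : ∀ j ∈ J, ∃ U ∈ G j, 0 < x U ∧ cc U M = 1 := fun j hj => (mem_filter.1 hj).2
    -- `J` is nonempty (`k ≥ 1`), so the cut type is inhabited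
    have hJne : J.Nonempty := by
      rw [nonempty_iff_ne_empty]; rintro hJ0
      rw [hJ0, card_empty, Nat.cast_zero, mul_zero] at hM
      exact absurd hM (by exact_mod_cast (Nat.zero_le k).not_gt)
    obtain ⟨j₀, hj₀⟩ := hJne
    obtain ⟨U₀, -⟩ := hw j₀ hj₀
    haveI : Nonempty (OddSet n) := ⟨U₀⟩
    choose! w hw using hw
    refine card_le_card_of_injOn w (fun j hj => mem_filter.2 ⟨mem_univ _, (hw j hj).2⟩) ?_
    intro j hj j' hj' hjj'
    by_contra hne
    have hdis := hGd j j' hne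
    exact disjoint_left.1 hdis (hw j hj).1 (hjj' ▸ (hw j' hj').1)
  have h1 : (J.card : ℝ) ≤ d := by exact_mod_cast hJle.trans (hinc M hyM)
  have h2 : (k : ℝ) < 2 * (d : ℝ) := by linarith
  exact_mod_cast h2

/-- **SPARSITY FROM AN INCIDENCE BOUND.** Under the (SNT-q)-existence hypothesis with heavy sub-weights (threshold `θ ≥ 0`), a cut weight
`0 ≤ x ≤ 1` all of whose active matchings have at most `d` active tight partners has total mass `Σ_U x_U < max(2d, 1)·(θ + 1)` (greedy
partition + the double count). [cite: Rothvoss2017, §2 (PDF pp. 5–6)] -/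
theorem sum_lt_of_incidence (x : OddSet n → ℝ) (hx : ∀ U, 0 ≤ x U ∧ x U ≤ 1) (y : PMatch n → ℝ) (hy : ∀ M, 0 ≤ y M)
    {θ : ℝ} (hθ : 0 ≤ θ)
    (hSNT : ∀ x' : OddSet n → ℝ, (∀ U, 0 ≤ x' U ∧ x' U ≤ x U) → θ ≤ ∑ U, x' U →
      ∀ y' : PMatch n → ℝ, (∀ M, 0 ≤ y' M ∧ y' M ≤ y M) → ∑ M, y M ≤ 2 * ∑ M, y' M →
        ∃ U M, cc U M = 1 ∧ 0 < x' U ∧ 0 < y' M)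
    {d : ℕ} (hinc : ∀ M, 0 < y M → (univ.filter fun U : OddSet n => 0 < x U ∧ cc U M = 1).card ≤ d) :
    ∑ U, x U < ((max (2 * d) 1 : ℕ) : ℝ) * (θ + 1) := by
  classical
  by_contra hge
  rw [not_lt] at hge
  set k := max (2 * d) 1 with hk
  have hkpos : 0 < k := lt_of_lt_of_le Nat.one_pos (le_max_right _ _)
  obtain ⟨G, -, hGθ, hGd⟩ := exists_disjoint_heavy_groups x (fun U => (hx U).2) hθ k univ (by rwa [hk])
  have hlt := groups_lt_two_mul_of_incidence x (fun U => (hx U).1) y hy hSNT hinc hkpos G hGθ hGd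
  have : 2 * d ≤ k := le_max_left _ _
  omega

/-! ### §4 Rank-one cut operators: tightness is annihilation, general position is sparsity -/

/-- `uuᵀ w = ⟨u, w⟩ u`. [folklore] -/
theorem vecMulVec_self_mulVec (u w : Fin r → ℝ) : vecMulVec u u *ᵥ w = (u ⬝ᵥ w) • u := by
  ext i
  simp [mulVec, vecMulVec, dotProduct, Finset.mul_sum, mul_comm, mul_left_comm]

/-- **Tightness is annihilation for rank-one cut operators.** In a tight-orthogonal psd rectangle with `X_U = x_U · u_Uu_Uᵀ`, `x_U > 0`,
`‖u_U‖ = 1`, every tight `M` has `Y_M u_U = 0`: the direction of an active tight partner lies in `ker Y_M`.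
[cite: BrietDadushPokutta2014, Thm. 6 (§3)] -/
theorem mulVec_eq_zero_of_tight_rankOne {X : OddSet n → Matrix (Fin r) (Fin r) ℝ} {Y : PMatch n → Matrix (Fin r) (Fin r) ℝ}
    (hXY : IsPsdRect X Y) {x : OddSet n → ℝ} {u : OddSet n → Fin r → ℝ} {U : OddSet n}
    (hX : X U = x U • vecMulVec (u U) (u U)) (hxU : 0 < x U) (hu : u U ⬝ᵥ u U = 1) {M : PMatch n} (hcc : cc U M = 1) :
    Y M *ᵥ u U = 0 := by
  -- `Y_M X_U = (X_U Y_M)ᵀ = 0` by symmetry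
  have hXs : (X U)ᵀ = X U := by
    have h := (hXY.1 U).1.1; rwa [IsHermitian, conjTranspose_eq_transpose_of_trivial] at h
  have hYs : (Y M)ᵀ = Y M := by
    have h := (hXY.2.1 M).1.1; rwa [IsHermitian, conjTranspose_eq_transpose_of_trivial] at h
  have hYX : Y M * X U = 0 := by
    have h := congrArg transpose (hXY.2.2 U M hcc)
    rwa [transpose_mul, transpose_zero, hXs, hYs] at h
  -- apply to `u_U`: `0 = Y_M (X_U u_U) = x_U · Y_M u_U`
  have h1 : (Y M * X U) *ᵥ u U = x U • (Y M *ᵥ u U) := by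
    rw [← mulVec_mulVec, hX, smul_mulVec, vecMulVec_self_mulVec, hu, one_smul, mulVec_smul]
  rw [hYX, zero_mulVec] at h1
  exact (smul_eq_zero.1 h1.symm).resolve_left hxU.ne'

/-- Hence under GENERAL POSITION of the active cut directions, every matching `M` with `tr Y_M > 0` has **fewer than `r` active tight
partners**. [cite: BrietDadushPokutta2014, Thm. 6 (§3)] -/
theorem card_active_tight_lt_of_generalPosition {X : OddSet n → Matrix (Fin r) (Fin r) ℝ}
    {Y : PMatch n → Matrix (Fin r) (Fin r) ℝ} (hXY : IsPsdRect X Y) (x : OddSet n → ℝ) (u : OddSet n → Fin r → ℝ)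
    (hX : ∀ U, X U = x U • vecMulVec (u U) (u U)) (hu : ∀ U, 0 < x U → u U ⬝ᵥ u U = 1)
    (hgp : ∀ T : Finset (OddSet n), (∀ U ∈ T, 0 < x U) → T.card = r → LinearIndependent ℝ (fun U : T => u U.1))
    {M : PMatch n} (hM : 0 < (Y M).trace) :
    (univ.filter fun U : OddSet n => 0 < x U ∧ cc U M = 1).card < r := by
  classical
  have hY : Y M ≠ 0 := fun h => by rw [h, trace_zero] at hM; exact lt_irrefl _ hM
  set S := univ.filter (fun U : OddSet n => 0 < x U) with hS
  have hgpS : ∀ T : Finset (OddSet n), T ⊆ S → T.card = r → LinearIndependent ℝ (fun U : T => u U.1) :=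
    fun T hT hTc => hgp T (fun U hU => (mem_filter.1 (hT hU)).2) hTc
  have h := card_annihilated_lt_of_generalPosition S u hgpS hY
  refine lt_of_le_of_lt (card_le_card fun U hU => ?_) h
  obtain ⟨-, hxU, hcc⟩ := mem_filter.1 hU
  exact mem_filter.2 ⟨mem_filter.2 ⟨mem_univ _, hxU⟩, mulVec_eq_zero_of_tight_rankOne hXY (hX U) hxU (hu U hxU) hcc⟩

/-- **GENERAL-POSITION BUDGET LEMMA (MEMO-14 §5(b)/(d)(4)).** Let `(X, Y)` be a tight-orthogonal psd rectangle of dimension `r ≥ 1` whose cut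
operators are RANK ONE, `X_U = x_U · u_Uu_Uᵀ` (`0 ≤ x_U ≤ 1`, `‖u_U‖ = 1` when `x_U > 0`), with the active directions in GENERAL POSITION, and
suppose the (SNT-q)-existence hypothesis with heavy sub-weights holds for `x` against the trace weight `M ↦ tr Y_M` at threshold `θ ≥ 0`.
Then `Σ_U x_U < max(2(r−1), 1)·(θ + 1)`: the cut side is `x`-sparse unless `r ≳ (Σ x)/(2θ)` — with `θ = ε·#t-cuts` this is
`r ≥ μ/(2ε)`, `μ` the `x`-density, the bound of MEMO-14 §5(b). [cite: Rothvoss2017, §2 (PDF pp. 5–6)] [cite: BrietDadushPokutta2014, Thm. 6 (§3)] -/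
theorem rankOne_cut_mass_lt_of_generalPosition (hr : 0 < r) {X : OddSet n → Matrix (Fin r) (Fin r) ℝ}
    {Y : PMatch n → Matrix (Fin r) (Fin r) ℝ} (hXY : IsPsdRect X Y) (x : OddSet n → ℝ) (u : OddSet n → Fin r → ℝ)
    (hx : ∀ U, 0 ≤ x U ∧ x U ≤ 1) (hX : ∀ U, X U = x U • vecMulVec (u U) (u U)) (hu : ∀ U, 0 < x U → u U ⬝ᵥ u U = 1)
    (hgp : ∀ T : Finset (OddSet n), (∀ U ∈ T, 0 < x U) → T.card = r → LinearIndependent ℝ (fun U : T => u U.1))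
    {θ : ℝ} (hθ : 0 ≤ θ)
    (hSNT : ∀ x' : OddSet n → ℝ, (∀ U, 0 ≤ x' U ∧ x' U ≤ x U) → θ ≤ ∑ U, x' U →
      ∀ y' : PMatch n → ℝ, (∀ M, 0 ≤ y' M ∧ y' M ≤ (Y M).trace) → ∑ M, (Y M).trace ≤ 2 * ∑ M, y' M →
        ∃ U M, cc U M = 1 ∧ 0 < x' U ∧ 0 < y' M) :
    ∑ U, x U < ((max (2 * (r - 1)) 1 : ℕ) : ℝ) * (θ + 1) := by
  have hy : ∀ M, 0 ≤ (Y M).trace := fun M => (hXY.2.1 M).1.trace_nonneg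
  refine sum_lt_of_incidence x hx (fun M => (Y M).trace) hy hθ hSNT (d := r - 1) fun M hM => ?_
  have := card_active_tight_lt_of_generalPosition hXY x u hX hu hgp hM
  omega

/-- The trace of a rank-one cut operator is its weight: `tr(x·uuᵀ) = x` for a unit `u` (and `= 0 = x` when `x = 0`). [folklore] -/
theorem trace_rankOne_eq {X : OddSet n → Matrix (Fin r) (Fin r) ℝ} (x : OddSet n → ℝ) (u : OddSet n → Fin r → ℝ)
    (hx : ∀ U, 0 ≤ x U) (hX : ∀ U, X U = x U • vecMulVec (u U) (u U)) (hu : ∀ U, 0 < x U → u U ⬝ᵥ u U = 1)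
    (U : OddSet n) : (X U).trace = x U := by
  rw [hX U, trace_smul, trace_vecMulVec, smul_eq_mul]
  rcases (hx U).eq_or_lt with h0 | hpos
  · rw [← h0, zero_mul]
  · rw [hu U hpos, mul_one]

/-- **Corollary (trace density).** In the situation of `rankOne_cut_mass_lt_of_generalPosition` the cut side's total trace is
`Σ_U tr X_U < 2r·(θ + 1)`, i.e. its normalised trace `Σ_U tr X_U / r < 2(θ + 1)`: with `θ = ε·#t-cuts` a general-position rank-one cut side has
trace DENSITY `< 2(ε + 1/#t-cuts)` in EVERY dimension — below any dense-cell threshold larger than twice the (SNT-q) threshold.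
[cite: Rothvoss2017, §2 (PDF pp. 5–6)] [cite: BrietDadushPokutta2014, Thm. 6 (§3)] -/
theorem rankOne_traceDensity_lt_of_generalPosition (hr : 0 < r) {X : OddSet n → Matrix (Fin r) (Fin r) ℝ}
    {Y : PMatch n → Matrix (Fin r) (Fin r) ℝ} (hXY : IsPsdRect X Y) (x : OddSet n → ℝ) (u : OddSet n → Fin r → ℝ)
    (hx : ∀ U, 0 ≤ x U ∧ x U ≤ 1) (hX : ∀ U, X U = x U • vecMulVec (u U) (u U)) (hu : ∀ U, 0 < x U → u U ⬝ᵥ u U = 1)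
    (hgp : ∀ T : Finset (OddSet n), (∀ U ∈ T, 0 < x U) → T.card = r → LinearIndependent ℝ (fun U : T => u U.1))
    {θ : ℝ} (hθ : 0 ≤ θ)
    (hSNT : ∀ x' : OddSet n → ℝ, (∀ U, 0 ≤ x' U ∧ x' U ≤ x U) → θ ≤ ∑ U, x' U →
      ∀ y' : PMatch n → ℝ, (∀ M, 0 ≤ y' M ∧ y' M ≤ (Y M).trace) → ∑ M, (Y M).trace ≤ 2 * ∑ M, y' M →
        ∃ U M, cc U M = 1 ∧ 0 < x' U ∧ 0 < y' M) :
    (∑ U, (X U).trace) / r < 2 * (θ + 1) := by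
  have hmass := rankOne_cut_mass_lt_of_generalPosition hr hXY x u hx hX hu hgp hθ hSNT
  have htr : ∑ U, (X U).trace = ∑ U, x U := sum_congr rfl fun U _ => trace_rankOne_eq x u (fun U => (hx U).1) hX hu U
  have hr' : (0 : ℝ) < r := by exact_mod_cast hr
  rw [htr, div_lt_iff₀ hr']
  refine lt_of_lt_of_le hmass ?_
  have hmax : ((max (2 * (r - 1)) 1 : ℕ) : ℝ) ≤ 2 * (r : ℝ) := by
    have : max (2 * (r - 1)) 1 ≤ 2 * r := by omega
    exact_mod_cast this
  have hθ1 : 0 ≤ θ + 1 := by linarith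
  nlinarith

end Summit.PneNP.PneNP.Theorems.ChebyshevTracialDesignGeneralPositionBudget
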